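import Literature.NumberTheory.LFunctions.Zhang2022.RepairRplusPlus5
import Literature.NumberTheory.LFunctions.Zhang2022.RepairIntakeBell
import Literature.NumberTheory.LFunctions.Zhang2022.RepairInPrintLengthsCeiling

/-!
# Zhang (2022) §18-margin repair rung — THE RUNNING ASSEMBLY `R⁺⁺`, continuation file (versions 14, …)

Trunk T-ANT (NumberTheory/LFunctions). Y. Zhang, *Discrete mean estimates and the Landau–Siegel
zero*, arXiv:2211.02515v1 (2022) [Zhang2022LandauSiegel] — **an unrefereed manuscript under
adjudication. WHAT THIS IS NOT: nothing here asserts or denies its Theorems 1–2 or any analytic lemma;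
no claim about Landau–Siegel zeros, about Parity, or about a repaired `Margin232` is made. Every
statement is about the manuscript's METHOD AS ARCHITECTED — classes of designs fed to the SAME main-term
calculus (or to a displayed MODEL main term) — not about zeros of `L`-functions.** Cell `landau-siegel`
(rung F-S3), sub-cell E, seat p1 (generation g2), stub S-E-p1-1 «running assembly» of barrier/ASSIGNMENTS.md.

Continuation of `RepairRplusPlus` (0–3), `RepairRplusPlus2` (4–6), `RepairRplusPlus3` (7–8), `RepairRplusPlus4` (9–11)
and `RepairRplusPlus5` (12–13; class of record before this file = `Repair.Rplusplus13`, p478102, 44 families, with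
`rplusplus13_words_sub` = the B-multi v6 / B-len v4 / B-det v2 intake lists as sub-lists); those files reached their
line budget. Same protocol (`Repair.DesignFamily`, `ClassDecided`, append-only versions `Rplusplus<k>`, class OF RECORD =
the last version, named in barrier/BARRIER-STATE.md; per version: `Rplusplus<k>`, `rplusplus<k>_decided` by
`classDecided_append` — nothing re-proved —, `mem_rplusplus<k>_iff`, prefix lemma, sub-list recoveries, the intake lists
of record as sub-lists, the verdicts, table rows in a `/-! ### Version k -/` section).

## Class table — version 14 (rows 45–49: the FOURTH design-class word, KILL(B-ell) INSIDE D_ell)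

**KILL(B-ell) INSIDE D_ell — OF RECORD 2026-08-27T00:20:49Z (director-frontier g6)**; §E intake rulings ls-barrier-plan g1
00:27:02Z / 00:30:01Z / 00:43:27Z «OF RECORD = THE FILED BYTES» (INTAKE-5 = `Zhang2022/RepairIntakeBell.lean`, p479175, ONE
writer ls-Bell-typer-2 g3, sha16 9049fbbc22c289e3, the FIVE-family shape; REF-B2 intake read NO OBJECTION 00:35:30Z, K_ell
class-wording PASS 00:31:18Z; DESIGN-CLASS word per KILL-INTAKE §6 D1′: its families become ROWS here via `bellWord ⊆`; C1 =
the director's sentence VERBATIM with riders R1/R2 and qualifiers (a)(b)(c), KILL-CERT(B-ell) v1 5625bef2660f98d2 §1, quoted in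
the intake file — NOT re-quoted here; currency «FIRST ORDER IN 1/A, kernel implication; TIER 2 K₀ plane REF-B2-exact»). The
five families live INSIDE the intake file (imported here — the assembly imports intake files, never conversely).

| # | family (decl) | designs, K in words | V (currency) | displayed inputs (kind) | p-id (file) | flag |
|---|---|---|---|---|---|---|
| 45 «ell (I) one-piece» | `familyBellOnePiece` | `(G, G′)` with `EllRegime.OnePieceWV G G′`: ONE-PIECE wall-vanishing profile run at `P = D^A` in the physical frame (K₀-POS and every one-piece POS design, any `A`) | MAIN ORDER: at every scale record `S` of the `P`-side regime with `A > 0`, `D ≥ 7`, `0 ≤ mainTermFormEll S.ellP (rescale S.shrink G) (rescale′ S.shrink G′)` — no one-piece POS design closes through the main-term form | none beyond the regime binders (kind (b) structural) | p479175 (`RepairIntakeBell`) ← p465723 `EllRegime.mainTerm_frame_nonneg` (ls-obj-eng-3) | **UNCONDITIONAL** at main order; reading `onePiece_closes_needs_negative_dict` (closing needs a NEGATIVE first-order dictionary term, E-022) |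
| 46 «ell (I′) K₀ plane» | `familyBellK0Plane` | `K0PlaneDesign (ι₁, ι₂, τ₀, l₁)`: coefficients on `(e₁, e₂) = (k₁+k₂, k₂+k₃)`, sheet height `τ₀ ≥ 0` (class), lower end `l₁` of the λ-range displayed with the design | FIRST ORDER (TIER 2, REF-B2-exact): `ModelConsistentOn (k0Model τ₀ l₁) 0 (k0G₀ …) (k0G₁ …) (k0G₂ …)` — the first-order value `G₀ + λG₁ + c′G₂` is `≥ 0` at EVERY model-admissible datum `(λ, c′) ∈ [l₁,0] × [c′_det(τ₀), ∞)` | none (kind (b) structural) | p479175 ← p472567 `EllRegime.modelConsistentOn_k0Plane` | **UNCONDITIONAL** at first order; `k0Plane_not_closes`, `k0Plane_not_closes_of_pinned` |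
| 47 «ell (II) first order» | `familyBellFirstOrder` | `((gain, G₀, G₁, G₂), 𝓜)`: the first-order data of a design of `D_ell` with its model-admissible set; `InClass := True` over abstract data — the member-specific content sits in the displayed premise (dict-1 of THAT member); the map «physical member ↦ premise shape» is S-E-bell-2 (`RepairIntakeBellMembers`, ls-Bell-typer-2 g3; NOT-COVERED ledger caveat N14) | FIRST ORDER (TIER 1): `FirstOrderExpansion 𝓜 data → ModelConsistentOn 𝓜 gain G₀ G₁ G₂` — GIVEN the premise, the closing region misses `𝓜` (`firstOrder_not_closes`) | ONE displayed premise, kind (c): `FirstOrderExpansion 𝓜 data` = B-AH∣_{U ∪ U_II} (E-014) ∧ dict-1 / hexp (E-022) (+ hexp_II OWED, riders R1/R2) | p479175 ← p470105 `EllRegime.modelConsistentOn_of_expansion` | **CONDITIONAL «GIVEN E-014∣_{U∪U_II} ∧ E-022»**; premise inhabited / load-bearing / unpremised-fails by term (`firstOrder_premise_inhabited`, `firstOrder_premise_loadBearing`, `firstOrder_unpremised_fails`); qualifier (b)'s possible SUSPENSION at 05:00Z = a docstring erratum on this row, no row dropped |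
| 48 «ell (II-CS) CS edge» | `familyBellCSEdge` | `CSEdgeDesign (D₀, D₁, J₀, J₁, X₀, X₁)`: first-order CS data on the tie/CS sheet with the zeroth order a CS EQUALITY `D₀J₀ = X₀²` (class; the edge where the ε-windows live) | FIRST ORDER, CS currency: `CSExactExpansion d → 0 ≤ D₀J₁ + D₁J₀ − 2X₀X₁` (the first-order CS margin is not negative) | ONE displayed premise, kind (c): `CSExactExpansion d` = exact Cauchy–Schwarz at every `A ≥ A₀` (**B-AH (B1)**, named, proved by no one) ∧ a bounded CS-remainder (dict-1 in CS currency, E-022) | p479175 ← p470105 `EllRegime.csFirstOrder_nonneg_of_exact` | **CONDITIONAL «GIVEN B-AH (B1) ∧ E-022-CS»**; `csEdge_premise_inhabited`, `csEdge_unpremised_fails` |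
| 49 «ell (III′) subcritical» | `familyBellSubcritical` | `(S, p) : Scales × ℝ` with `0 < p`, `0 < t₀`, `4π² < D`, `1 < p·√D·t₀` (a scale record and a prime-window point) | `¬ (S.ell p < 1)`: the subcritical «`ℓ < 1`» design (ELL-E) is NOT realisable | none | p479175 ← p456970 `EllScales.Scales.one_lt_ell` | **UNCONDITIONAL** |

Intake lists of record inside version 14 (`rplusplus14_words_sub`): `bmultiWord6` (B-multi v6), `blenWord4` (B-len v4), `bdetWord2`
(B-det v2), `bellWord` (B-ell: rows 45–49). NOT rows (never listed): the sum families `familyBmulti6` / `familyBlen4` / `familyBdet2` /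
`familyBell` (they ARE the words), `bfamWord` (B-fam: separate decided class, its own conjunct of the §6 D1 sentence),
`DH.menuConsistent_holds` (B-dh: a target). EXITS of the B-ell word (K₀^R = E*-len, shift redesign D-ELL-2, ELL-D lookups, the
`B ≤ ½` price clause E-016, `x = 0` keep-admissibility ell-E14) are docstring text of the intake, never Lean statements. The
withdrawn three-family restructure (253c656b448a9fd0: `EllAdmissible` on physical exponents, `DirectDesign`/`TwoSidedDesign` with
slots `BAH`/`HExp`) returns as the MEMBERS file S-E-bell-2 (no new row unless booked). The §6 D1 sentence of record =
ls-barrier-p5 g3's `Repair.doneCondition_v<k>` (RepairDoneCondition.lean; `_v14` adds `(∀ F ∈ bellWord, F ∈ Rplusplus14)`).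

## References

* Y. Zhang, arXiv:2211.02515v1 (2022), §2 Lemma 2.3, (2.10), (2.13), (2.15)–(2.20), (2.23)–(2.25), (2.30)–(2.33)
  [p. 4–11], §7 Prop. 7.1, (7.2) [p. 44], §8 Lemma 8.1, (8.23). [cite: Zhang2022LandauSiegel, §§2, 7, 8]
-/

noncomputable section

open scoped ComplexOrder NNReal

namespace Literature.NumberTheory.LFunctions.Zhang2022

namespace Repair

/-! ### Version 14 (2026-08-27): the KILL(B-ell) intake's five families as rows 45–49 -/

/-- **`R⁺⁺`, version 14**: version 13 (`RepairRplusPlus5.Rplusplus13`, 44 families) followed by the five families of the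
KILL(B-ell) intake (`familyBellOnePiece`, `familyBellK0Plane`, `familyBellFirstOrder`, `familyBellCSEdge`,
`familyBellSubcritical` — RepairIntakeBell p479175, in `bellWord` order) — rows 45–49.
[cite: Zhang2022LandauSiegel, §2 (2.10), (2.13), (2.30)–(2.33)] -/
def Rplusplus14 : List DesignFamily :=
  Rplusplus13 ++ [familyBellOnePiece, familyBellK0Plane, familyBellFirstOrder, familyBellCSEdge, familyBellSubcritical]

/-- **Version 14 is decided**: `rplusplus13_decided` for rows 1–44 and the five landed `…_decided` theorems of the
B-ell intake for rows 45–49; nothing re-proved. [cite: Zhang2022LandauSiegel, §2 Props. 2.4–2.6, (2.10), (2.32)–(2.33)] -/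
theorem rplusplus14_decided : ClassDecided Rplusplus14 :=
  classDecided_append.2 ⟨rplusplus13_decided,
    classDecided_cons familyBellOnePiece_decided <| classDecided_cons familyBellK0Plane_decided <|
      classDecided_cons familyBellFirstOrder_decided <| classDecided_cons familyBellCSEdge_decided <|
        classDecided_cons familyBellSubcritical_decided classDecided_nil⟩

/-- The families of version 14, by name (the class is EXACTLY these forty-nine).
[cite: Zhang2022LandauSiegel, §2 (2.32)–(2.33)] -/
theorem mem_rplusplus14_iff (F : DesignFamily) :
    F ∈ Rplusplus14 ↔ F = familyR ∨ F = familyH1 ∨ F = familyTwoPiece ∨ F = familyFarPiece ∨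
      F = familyRWide ∨ F = familyRCalc ∨ F = KnifeEdge.familyRoughTwoPiece ∨ F = familyRLengths ∨
      F = familySmoothLengths ∨ F = familySmoothTop ∨ F = familyTwoPieceJoint ∨ F = familyWallZero ∨
      F = familyWallZeroTop ∨ F = familyInPrintLen ∨ F = KnifeEdge.familyWallBand ∨ F = familyJumpBlockAll ∨
      F = familyDetShift ∨ F = KnifeEdge.familyRoughThreePiece ∨ F = KnifeEdge.familyRoughTwoPieceJoint ∨
      F = familyFarBV ∨ F = familyLambdaBlockAll ∨ F = familyWallZeroMain ∨ F = familyWallZeroTopMain ∨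
      F = KnifeEdge.familyGramBlockAll ∨ F = familyLambdaOverhangAll ∨ F = familyLambdaGradedAll ∨
      F = KnifeEdge.familyGramBlockDict ∨ F = KnifeEdge.familyGramBordered ∨ F = familyMuPsiOverhangAll ∨
      F = familyNuOverhangAll ∨ F = familyBandEdge ∨ F = familySmoothBandEdge ∨ F = familySmoothTopBandEdge ∨
      F = familyNuLipOverhangAll ∨ F = familyWallZeroTrueBand ∨ F = familyWallZeroTopTrueBand ∨
      F = familySmoothWallZeroTrueBand ∨ F = familySmoothTopWallZeroTrueBand ∨ F = familyLambdaWholeAll ∨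
      F = familyDetEntangled ∨ F = familyWallZeroBandMV ∨ F = familyWallZeroTopBandMV ∨
      F = familySmoothWallZeroBandMV ∨ F = familySmoothTopWallZeroBandMV ∨ F = familyBellOnePiece ∨
      F = familyBellK0Plane ∨ F = familyBellFirstOrder ∨ F = familyBellCSEdge ∨ F = familyBellSubcritical := by
  simp only [Rplusplus14, Rplusplus13, Rplusplus12, Rplusplus11, Rplusplus10, Rplusplus9, Rplusplus8, Rplusplus7,
    Rplusplus6, Rplusplus5, Rplusplus4, Rplusplus3, Rplusplus2, Rplusplus1, Rplus, List.cons_append, List.nil_append,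
    List.mem_cons, List.not_mem_nil, or_false]

/-- **Version 13 ⊆ version 14** (list prefix: no family dropped). [cite: Zhang2022LandauSiegel, §2 (2.32)–(2.33)] -/
theorem rplusplus13_sub_rplusplus14 : ∀ F ∈ Rplusplus13, F ∈ Rplusplus14 :=
  fun _ hF => List.mem_append.2 (Or.inl hF)

/-- `R⁺ ⊆` version 14. [cite: Zhang2022LandauSiegel, §2 (2.32)–(2.33)] -/
theorem rplus_sub_rplusplus14 : ∀ F ∈ Rplus, F ∈ Rplusplus14 :=
  fun F hF => rplusplus13_sub_rplusplus14 F (rplus_sub_rplusplus13 F hF)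

set_option maxHeartbeats 400000 in
/-- Version 14 restricted to version 13, and the intake file's own `R⁺ ++ bellWord` (`rplus_bellWord_decided`) as a
sub-list. [cite: Zhang2022LandauSiegel, §2 (2.32)–(2.33)] -/
theorem rplusplus14_decided_sublists : ClassDecided Rplusplus13 ∧ ClassDecided (Rplus ++ bellWord) := by
  refine ⟨rplusplus14_decided.mono rplusplus13_sub_rplusplus14, rplusplus14_decided.mono fun F hF => ?_⟩
  rcases List.mem_append.1 hF with h | h
  · exact rplus_sub_rplusplus14 F h
  · simp only [bellWord, List.mem_cons, List.not_mem_nil, or_false] at h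
    rw [mem_rplusplus14_iff]
    tauto

/-- **The KILL(B-ell) intake list is inside version 14**: every family of `bellWord` (RepairIntakeBell p479175) is one of
rows 45–49. [cite: Zhang2022LandauSiegel, §2 (2.10), (2.32)–(2.33)] -/
theorem bellWord_sub_rplusplus14 : ∀ F ∈ bellWord, F ∈ Rplusplus14 := by
  intro F hF
  simp only [bellWord, List.mem_cons, List.not_mem_nil, or_false] at hF
  rw [mem_rplusplus14_iff]
  tauto

/-- … hence `bellWord_decided` is an instance of `rplusplus14_decided` (the word's class is decided BECAUSE the class of
record is). [cite: Zhang2022LandauSiegel, §2 (2.32)–(2.33)] -/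
theorem rplusplus14_decided_bellWord : ClassDecided bellWord := rplusplus14_decided.mono bellWord_sub_rplusplus14

/-- **All FOUR design-class words' current intake lists are inside version 14**: B-multi v6 (`bmultiWord6`), B-len v4
(`blenWord4`), B-det v2 (`bdetWord2`), B-ell (`bellWord`). [cite: Zhang2022LandauSiegel, §2 (2.32)–(2.33); §7 Prop 7.1 (7.2) p.44] -/
theorem rplusplus14_words_sub :
    (∀ F ∈ bmultiWord6, F ∈ Rplusplus14) ∧ (∀ F ∈ blenWord4, F ∈ Rplusplus14) ∧ (∀ F ∈ bdetWord2, F ∈ Rplusplus14) ∧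
      (∀ F ∈ bellWord, F ∈ Rplusplus14) :=
  ⟨fun F hF => rplusplus13_sub_rplusplus14 F (rplusplus13_words_sub.1 F hF),
    fun F hF => rplusplus13_sub_rplusplus14 F (rplusplus13_words_sub.2.1 F hF),
    fun F hF => rplusplus13_sub_rplusplus14 F (rplusplus13_words_sub.2.2 F hF), bellWord_sub_rplusplus14⟩

/-- … so the union of the four intake lists is decided, as a sub-list of version 14.
[cite: Zhang2022LandauSiegel, §2 (2.32)–(2.33)] -/
theorem rplusplus14_decided_fourWords : ClassDecided (bmultiWord6 ++ blenWord4 ++ bdetWord2 ++ bellWord) := by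
  refine rplusplus14_decided.mono fun F hF => ?_
  rcases List.mem_append.1 hF with h | h
  · rcases List.mem_append.1 h with h' | h'
    · rcases List.mem_append.1 h' with h'' | h''
      · exact rplusplus14_words_sub.1 F h''
      · exact rplusplus14_words_sub.2.1 F h''
    · exact rplusplus14_words_sub.2.2.1 F h'
  · exact rplusplus14_words_sub.2.2.2 F h

/-- … and the four words as ONE family each (the sum families, never rows): `R⁺ ++ [familyBmulti6, familyBlen4, familyBdet2,
familyBell]` is decided — cited by term from the intake files. [cite: Zhang2022LandauSiegel, §2 (2.32)–(2.33)] -/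
theorem rplus_fourWords_asFamilies_decided :
    ClassDecided (Rplus ++ [familyBmulti6, familyBlen4, familyBdet2, familyBell]) :=
  classDecided_append.2 ⟨rplus_decided, classDecided_cons familyBmulti6_decided <|
    classDecided_cons familyBlen4_decided <| classDecided_cons familyBdet2_decided <|
      classDecided_cons familyBell_decided classDecided_nil⟩

/-- **Reading of rows 45–49, row by row** (class binder ⇒ verdict, by the landed terms): one-piece main order, the K₀ plane
at first order, the first-order reading GIVEN its premise, the CS edge GIVEN its premise, the subcritical row.
[cite: Zhang2022LandauSiegel, §2 Lemma 2.3, (2.10), (2.13), (2.18)–(2.20), (2.30), (2.32)–(2.33)] -/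
theorem rplusplus14_verdicts :
    (∀ p, familyBellOnePiece.InClass p → familyBellOnePiece.Verdict p) ∧
    (∀ d : K0PlaneDesign, 0 ≤ d.τ₀ → familyBellK0Plane.Verdict d) ∧
    (∀ p, familyBellFirstOrder.Verdict p) ∧
    (∀ d : CSEdgeDesign, d.D₀ * d.J₀ = d.X₀ ^ 2 → CSExactExpansion d →
        0 ≤ d.D₀ * d.J₁ + d.D₁ * d.J₀ - 2 * d.X₀ * d.X₁) ∧
    (∀ p, familyBellSubcritical.InClass p → familyBellSubcritical.Verdict p) :=
  ⟨fun p h => familyBellOnePiece_decided p h, fun d h => familyBellK0Plane_decided d h,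
    fun p => familyBellFirstOrder_decided p trivial, fun d h0 h => familyBellCSEdge_decided d h0 h,
    fun p h => familyBellSubcritical_decided p h⟩

/-- **Row 47 has NO class restriction** (`InClass := True`: the content is the displayed premise) — recorded so the referee's
C6 reading is immediate: the verdict is the implication `FirstOrderExpansion 𝓜 data → ModelConsistentOn …` for EVERY datum.
[cite: Zhang2022LandauSiegel, §2 Lemma 2.3, (2.32)] -/
theorem bellFirstOrder_class_trivial (p : familyBellFirstOrder.Design) : familyBellFirstOrder.InClass p := trivial

/-! ### Version 15 (2026-08-27): E-004″ — the CLASS-RESTRICTED band mean-value rows of record 41′–44′ (p480299, p2 g3)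

**Why (the author's own DESK-MODEL refutation of a slot's genericity, ls-barrier-p2 g3 00:53:36Z / 01:01:36Z):** rows 41–44
(version 13) display `Repair.BandMeanValue c′ 1078 κ`, a mean-value bound over ARBITRARY coefficient sequences; in the
(t-average × ψ-orthogonality) model that premise is FALSE for every fixed κ (D-periodic / phase-aligned coefficient witnesses,
both OUTSIDE the profile classes). So rows 41–44 are TRUE implications with a MODEL-FALSE premise — kept as landed (append-only),
flagged «NOT PROBATIVE; premise model-false for arbitrary coefficients», and SUPERSEDED FOR COVERAGE by rows 50–53 below, whose
slot is the CLASS-RESTRICTED form E-004″ `Repair.BandMeanValueLip c′ K m κ := BandMeanValueOn (profCoefClass K) c′ m κ`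
(RepairBandMeanValue v2, p479973: «the family mean square of the band block of a wall-zero K-Lipschitz profile is ≤ 𝓛^κ ×
its diagonal» — a mean-square form of E-004 ITSELF with the room 𝓛⁶ explicit, NOT a generic large-sieve statement; expected
TRUE in the same model, loss O(1)). NOT-COVERED ledger N1 wording of record: «E-004 ⇐ E-004″(κ<6) = `BandMeanValueLip`; the
all-coefficients form E-004′ is model-false and only a logical upper bound» (`BandMeanValue.lip`: E-004′ ⇒ E-004″).

| # | family (decl) | designs, K in words | V (currency) | displayed inputs (kind) | p-id (file) | flag |
|---|---|---|---|---|---|---|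
| 50 = 41′ «wall0, band MV-Lip» | `familyWallZeroBandMVLip` | `WallZeroDesign (c′, g)` = rows 12/22/35/41 UNCHANGED | as row 41 (clean main-scale form from the wall to any bounded length, ∀ δ η κ<6, GIVEN the slot + Prop71/Lemma81/Prop22i/Lemma23 + (A) + (b)) | ONE analytic slot, kind (c): **`Repair.BandMeanValueLip c′ 1 1078 κ`** = E-004″ (class-restricted to `profCoefClass 1` = coefficients of wall-zero 1-Lipschitz profiles) | p480299 (`RepairRplusBandMV` v2, ls-barrier-p2 g3) ← p479973 (`RepairBandMeanValue` v2) | ROW OF RECORD for the wall-zero true-band seam; SUPERSEDES 41 (and 35) FOR COVERAGE, all kept; bookkeeping `verdictBandMVLip_of_bandMeanValue_hyp` (row 41's premise implies row 50's) |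
| 51 = 42′ «wall0top, band MV-Lip» | `familyWallZeroTopBandMVLip` | `WallZeroTopDesign` = rows 13/23/36/42 | as row 42, FULL polynomial | `BandMeanValueLip c′ 1 1078 κ` (c) | p480299 | ROW OF RECORD; supersedes 42 (and 36) for coverage |
| 52 = 43′ «glued wall0, band MV-Lip» | `familySmoothWallZeroBandMVLip` | `SmoothDesign` with `d.InClass ∧ g(1) = 0` = rows 37/43's class LITERALLY (`familySmoothWallZeroBandMVLip_inClass_iff`) | as row 43 (glued class `(K, M)`, bounded lengths) | **`BandMeanValueLip c′ d.K 1078 κ`** (c) — the slot at the design's OWN Lipschitz constant | p480299 | ROW OF RECORD; supersedes 43 (and 37) for coverage; C4 `familyBandMVLip_members` |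
| 53 = 44′ «glued wall0top, band MV-Lip» | `familySmoothTopWallZeroBandMVLip` | `SmoothTopDesign` with `d.InClass ∧ g(1) = 0` = rows 38/44's class (`familySmoothTopWallZeroBandMVLip_inClass_iff`) | as row 44, FULL polynomial | `BandMeanValueLip c′ d.K 1078 κ` (c) | p480299 | ROW OF RECORD; supersedes 44 (and 38) for coverage; `rplus_bandMVLip_decided` is the slice file's `R⁺ ++ [50, 51, 52, 53]` |

Words: no change (`rplusplus15_words_sub` inherits the four design-class intake lists from version 14). Class of record before this
version = `Rplusplus14` (p479930; ls-barrier-plan g1 BOOKED 00:59:56Z). -/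

/-- **`R⁺⁺`, version 15**: version 14 followed by the four CLASS-RESTRICTED band mean-value families of record
(`familyWallZeroBandMVLip`, `familyWallZeroTopBandMVLip`, `familySmoothWallZeroBandMVLip`, `familySmoothTopWallZeroBandMVLip`,
p480299) — rows 50–53 = 41′–44′ (slot E-004″ `BandMeanValueLip`). [cite: Zhang2022LandauSiegel, §2 (2.16)–(2.20), (2.30)–(2.33); §7 Prop 7.1; §8 Lemma 8.1] -/
def Rplusplus15 : List DesignFamily :=
  Rplusplus14 ++ [familyWallZeroBandMVLip, familyWallZeroTopBandMVLip, familySmoothWallZeroBandMVLip,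
    familySmoothTopWallZeroBandMVLip]

/-- **Version 15 is decided**: `rplusplus14_decided` for rows 1–49 and the four landed `…_decided` theorems (p480299) for
rows 50–53; nothing re-proved. [cite: Zhang2022LandauSiegel, §2 Props. 2.4–2.6, (2.16)–(2.20), (2.32)–(2.33); §8 Lemma 8.1] -/
theorem rplusplus15_decided : ClassDecided Rplusplus15 :=
  classDecided_append.2 ⟨rplusplus14_decided,
    classDecided_cons familyWallZeroBandMVLip_decided <| classDecided_cons familyWallZeroTopBandMVLip_decided <|
      classDecided_cons familySmoothWallZeroBandMVLip_decided <|
        classDecided_cons familySmoothTopWallZeroBandMVLip_decided classDecided_nil⟩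

/-- The families of version 15, by name (the class is EXACTLY these fifty-three).
[cite: Zhang2022LandauSiegel, §2 (2.32)–(2.33)] -/
theorem mem_rplusplus15_iff (F : DesignFamily) :
    F ∈ Rplusplus15 ↔ F = familyR ∨ F = familyH1 ∨ F = familyTwoPiece ∨ F = familyFarPiece ∨
      F = familyRWide ∨ F = familyRCalc ∨ F = KnifeEdge.familyRoughTwoPiece ∨ F = familyRLengths ∨
      F = familySmoothLengths ∨ F = familySmoothTop ∨ F = familyTwoPieceJoint ∨ F = familyWallZero ∨
      F = familyWallZeroTop ∨ F = familyInPrintLen ∨ F = KnifeEdge.familyWallBand ∨ F = familyJumpBlockAll ∨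
      F = familyDetShift ∨ F = KnifeEdge.familyRoughThreePiece ∨ F = KnifeEdge.familyRoughTwoPieceJoint ∨
      F = familyFarBV ∨ F = familyLambdaBlockAll ∨ F = familyWallZeroMain ∨ F = familyWallZeroTopMain ∨
      F = KnifeEdge.familyGramBlockAll ∨ F = familyLambdaOverhangAll ∨ F = familyLambdaGradedAll ∨
      F = KnifeEdge.familyGramBlockDict ∨ F = KnifeEdge.familyGramBordered ∨ F = familyMuPsiOverhangAll ∨
      F = familyNuOverhangAll ∨ F = familyBandEdge ∨ F = familySmoothBandEdge ∨ F = familySmoothTopBandEdge ∨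
      F = familyNuLipOverhangAll ∨ F = familyWallZeroTrueBand ∨ F = familyWallZeroTopTrueBand ∨
      F = familySmoothWallZeroTrueBand ∨ F = familySmoothTopWallZeroTrueBand ∨ F = familyLambdaWholeAll ∨
      F = familyDetEntangled ∨ F = familyWallZeroBandMV ∨ F = familyWallZeroTopBandMV ∨
      F = familySmoothWallZeroBandMV ∨ F = familySmoothTopWallZeroBandMV ∨ F = familyBellOnePiece ∨
      F = familyBellK0Plane ∨ F = familyBellFirstOrder ∨ F = familyBellCSEdge ∨ F = familyBellSubcritical ∨
      F = familyWallZeroBandMVLip ∨ F = familyWallZeroTopBandMVLip ∨ F = familySmoothWallZeroBandMVLip ∨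
      F = familySmoothTopWallZeroBandMVLip := by
  simp only [Rplusplus15, Rplusplus14, Rplusplus13, Rplusplus12, Rplusplus11, Rplusplus10, Rplusplus9, Rplusplus8,
    Rplusplus7, Rplusplus6, Rplusplus5, Rplusplus4, Rplusplus3, Rplusplus2, Rplusplus1, Rplus, List.cons_append,
    List.nil_append, List.mem_cons, List.not_mem_nil, or_false]

/-- **Version 14 ⊆ version 15** (list prefix: no family dropped). [cite: Zhang2022LandauSiegel, §2 (2.32)–(2.33)] -/
theorem rplusplus14_sub_rplusplus15 : ∀ F ∈ Rplusplus14, F ∈ Rplusplus15 :=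
  fun _ hF => List.mem_append.2 (Or.inl hF)

/-- `R⁺ ⊆` version 15. [cite: Zhang2022LandauSiegel, §2 (2.32)–(2.33)] -/
theorem rplus_sub_rplusplus15 : ∀ F ∈ Rplus, F ∈ Rplusplus15 :=
  fun F hF => rplusplus14_sub_rplusplus15 F (rplus_sub_rplusplus14 F hF)

set_option maxHeartbeats 400000 in
/-- Version 15 restricted to version 14, and the slice file's own `R⁺ ++ [50, 51, 52, 53]` (`rplus_bandMVLip_decided`) as a
sub-list. [cite: Zhang2022LandauSiegel, §2 (2.32)–(2.33)] -/
theorem rplusplus15_decided_sublists :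
    ClassDecided Rplusplus14 ∧
      ClassDecided (Rplus ++ [familyWallZeroBandMVLip, familyWallZeroTopBandMVLip, familySmoothWallZeroBandMVLip,
        familySmoothTopWallZeroBandMVLip]) := by
  refine ⟨rplusplus15_decided.mono rplusplus14_sub_rplusplus15, rplusplus15_decided.mono fun F hF => ?_⟩
  rcases List.mem_append.1 hF with h | h
  · exact rplus_sub_rplusplus15 F h
  · simp only [List.mem_cons, List.not_mem_nil, or_false] at h
    rw [mem_rplusplus15_iff]
    tauto

/-- **The four design-class words' current intake lists are inside version 15** (inherited from version 14).
[cite: Zhang2022LandauSiegel, §2 (2.32)–(2.33)] -/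
theorem rplusplus15_words_sub :
    (∀ F ∈ bmultiWord6, F ∈ Rplusplus15) ∧ (∀ F ∈ blenWord4, F ∈ Rplusplus15) ∧ (∀ F ∈ bdetWord2, F ∈ Rplusplus15) ∧
      (∀ F ∈ bellWord, F ∈ Rplusplus15) :=
  ⟨fun F hF => rplusplus14_sub_rplusplus15 F (rplusplus14_words_sub.1 F hF),
    fun F hF => rplusplus14_sub_rplusplus15 F (rplusplus14_words_sub.2.1 F hF),
    fun F hF => rplusplus14_sub_rplusplus15 F (rplusplus14_words_sub.2.2.1 F hF),
    fun F hF => rplusplus14_sub_rplusplus15 F (rplusplus14_words_sub.2.2.2 F hF)⟩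

/-- **Rows 50–53 have EXACTLY the classes of rows 41–44** (and of 35–38): only the displayed slot changed (E-004′ all
coefficients ⟶ E-004″ class-restricted) — the bookkeeping behind «50–53 are the rows of record; 41–44 kept, not probative».
[cite: Zhang2022LandauSiegel, §2 (2.16)–(2.20)] -/
theorem bandMVLip_sameClass :
    (∀ d : WallZeroDesign, familyWallZeroBandMVLip.InClass d ↔ familyWallZeroBandMV.InClass d) ∧
      (∀ d : WallZeroTopDesign, familyWallZeroTopBandMVLip.InClass d ↔ familyWallZeroTopBandMV.InClass d) ∧
      (∀ d : SmoothDesign, familySmoothWallZeroBandMVLip.InClass d ↔ familySmoothWallZeroBandMV.InClass d) ∧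
      (∀ d : SmoothTopDesign, familySmoothTopWallZeroBandMVLip.InClass d ↔ familySmoothTopWallZeroBandMV.InClass d) :=
  ⟨fun _ => Iff.rfl, fun _ => Iff.rfl, fun _ => Iff.rfl, fun _ => Iff.rfl⟩

/-- **Row 41's premise implies row 50's verdict** on every member (E-004′ ⇒ E-004″: `verdictBandMVLip_of_bandMeanValue_hyp`),
recorded at the design level. [cite: Zhang2022LandauSiegel, §2 (2.16)–(2.20)] -/
theorem rplusplus15_verdicts :
    (∀ d : WallZeroDesign, d.InClass → d.VerdictBandMVLip) ∧ (∀ d : WallZeroTopDesign, d.InClass → d.VerdictBandMVLip) ∧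
      (∀ d : SmoothDesign, d.InClass → d.g 1 = 0 → d.VerdictBandMVLip) ∧
      (∀ d : SmoothTopDesign, d.InClass → d.g 1 = 0 → d.VerdictBandMVLip) :=
  ⟨fun d h => familyWallZeroBandMVLip_decided d h, fun d h => familyWallZeroTopBandMVLip_decided d h,
    fun d h h0 => familySmoothWallZeroBandMVLip_decided d ⟨h, h0⟩,
    fun d h h0 => familySmoothTopWallZeroBandMVLip_decided d ⟨h, h0⟩⟩

/-! ### Version 16 (2026-08-27): the in-print CEILING threshold row (T-2 addendum; NON-COVERING — ls-barrier-plan g1 01:09:34Z)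

| # | family (decl) | designs, K in words | V (currency) | displayed inputs (kind) | p-id (file) | flag |
|---|---|---|---|---|---|---|
| 54 «in-print ceiling (T-2′)» | `familyInPrintCeiling` | `Theta` boxes with `AdmissibleThetaLen θ` = row 14's class EXACTLY (`familyInPrintLen_verdict_iff`; ⊇ class `R`: `familyR_inClass_toCeiling`) — lengths `ν₁` read against the PRINT CEILING of the asymptotic-large-sieve / twisted-moment technology (Conrey–Iwaniec–Soundararajan ALS Thms 2.2/2.4, CIS 2019, BPRZ one-prime-modulus), reconstructed exponent bookkeeping labelled in the slice file | T-true currency (`¬ (C232S θ · C233T θ < ‖dSumS θ‖²)`, as rows 1 and 14) GIVEN the ENLARGED in-print slot | ONE slot, kind (c): `Repair.InPrintOffDiagonalRangeCeiling θ` = T-2's four printed inputs ∨ the ALS block reading, per block (`printedAsymptoticRange_iff_lt_one`: the printed asymptotic ranges reach the wall `ν < 1` and never cross it; `not_alsBlockControls`) | p479134 (`RepairInPrintLengthsCeiling`, ls-barrier-p4 g3, S-E-p4-9) ← p459189 (T-2), CIS-ALS p452329 / p453166 | **THRESHOLD, NON-COVERING — «counts for no word»** (row-14 precedent, T-2′):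 the slot is FALSE for every length `≥ P` (`familyInPrintCeiling_verdict_vacuous_beyond_wall`: beyond the wall the verdict holds vacuously, i.e. says nothing); booked by ls-barrier-plan g1 01:09:34Z «coverage count unchanged» |

Class of record before this version = `Rplusplus15` (p480809). Words unchanged (`rplusplus16_words_sub` inherited). -/

/-- **`R⁺⁺`, version 16**: version 15 followed by the in-print CEILING threshold family (`familyInPrintCeiling`, p479134) —
row 54, NON-COVERING. [cite: Zhang2022LandauSiegel, §2 (2.32)–(2.33); §7 (7.2), (7.15)] -/
def Rplusplus16 : List DesignFamily := Rplusplus15 ++ [familyInPrintCeiling]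

/-- **Version 16 is decided**: `rplusplus15_decided` for rows 1–53 and `familyInPrintCeiling_decided` (p479134) for row 54;
nothing re-proved. [cite: Zhang2022LandauSiegel, §2 Props. 2.4–2.6, (2.32)–(2.33); §7 (7.15)] -/
theorem rplusplus16_decided : ClassDecided Rplusplus16 := classDecided_snoc rplusplus15_decided familyInPrintCeiling_decided

/-- The families of version 16, by name (the class is EXACTLY these fifty-four).
[cite: Zhang2022LandauSiegel, §2 (2.32)–(2.33)] -/
theorem mem_rplusplus16_iff (F : DesignFamily) :
    F ∈ Rplusplus16 ↔ F = familyR ∨ F = familyH1 ∨ F = familyTwoPiece ∨ F = familyFarPiece ∨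
      F = familyRWide ∨ F = familyRCalc ∨ F = KnifeEdge.familyRoughTwoPiece ∨ F = familyRLengths ∨
      F = familySmoothLengths ∨ F = familySmoothTop ∨ F = familyTwoPieceJoint ∨ F = familyWallZero ∨
      F = familyWallZeroTop ∨ F = familyInPrintLen ∨ F = KnifeEdge.familyWallBand ∨ F = familyJumpBlockAll ∨
      F = familyDetShift ∨ F = KnifeEdge.familyRoughThreePiece ∨ F = KnifeEdge.familyRoughTwoPieceJoint ∨
      F = familyFarBV ∨ F = familyLambdaBlockAll ∨ F = familyWallZeroMain ∨ F = familyWallZeroTopMain ∨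
      F = KnifeEdge.familyGramBlockAll ∨ F = familyLambdaOverhangAll ∨ F = familyLambdaGradedAll ∨
      F = KnifeEdge.familyGramBlockDict ∨ F = KnifeEdge.familyGramBordered ∨ F = familyMuPsiOverhangAll ∨
      F = familyNuOverhangAll ∨ F = familyBandEdge ∨ F = familySmoothBandEdge ∨ F = familySmoothTopBandEdge ∨
      F = familyNuLipOverhangAll ∨ F = familyWallZeroTrueBand ∨ F = familyWallZeroTopTrueBand ∨
      F = familySmoothWallZeroTrueBand ∨ F = familySmoothTopWallZeroTrueBand ∨ F = familyLambdaWholeAll ∨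
      F = familyDetEntangled ∨ F = familyWallZeroBandMV ∨ F = familyWallZeroTopBandMV ∨
      F = familySmoothWallZeroBandMV ∨ F = familySmoothTopWallZeroBandMV ∨ F = familyBellOnePiece ∨
      F = familyBellK0Plane ∨ F = familyBellFirstOrder ∨ F = familyBellCSEdge ∨ F = familyBellSubcritical ∨
      F = familyWallZeroBandMVLip ∨ F = familyWallZeroTopBandMVLip ∨ F = familySmoothWallZeroBandMVLip ∨
      F = familySmoothTopWallZeroBandMVLip ∨ F = familyInPrintCeiling := by
  simp only [Rplusplus16, Rplusplus15, Rplusplus14, Rplusplus13, Rplusplus12, Rplusplus11, Rplusplus10, Rplusplus9,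
    Rplusplus8, Rplusplus7, Rplusplus6, Rplusplus5, Rplusplus4, Rplusplus3, Rplusplus2, Rplusplus1, Rplus,
    List.cons_append, List.nil_append, List.mem_cons, List.not_mem_nil, or_false]

/-- **Version 15 ⊆ version 16** (list prefix: no family dropped). [cite: Zhang2022LandauSiegel, §2 (2.32)–(2.33)] -/
theorem rplusplus15_sub_rplusplus16 : ∀ F ∈ Rplusplus15, F ∈ Rplusplus16 :=
  fun _ hF => List.mem_append.2 (Or.inl hF)

/-- `R⁺ ⊆` version 16. [cite: Zhang2022LandauSiegel, §2 (2.32)–(2.33)] -/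
theorem rplus_sub_rplusplus16 : ∀ F ∈ Rplus, F ∈ Rplusplus16 :=
  fun F hF => rplusplus15_sub_rplusplus16 F (rplus_sub_rplusplus15 F hF)

/-- Version 16 restricted to version 15, and the slice file's own `R⁺ ++ [familyInPrintCeiling]`
(`rplus_inPrintCeiling_decided`) as a sub-list. [cite: Zhang2022LandauSiegel, §2 (2.32)–(2.33)] -/
theorem rplusplus16_decided_sublists :
    ClassDecided Rplusplus15 ∧ ClassDecided (Rplus ++ [familyInPrintCeiling]) := by
  refine ⟨rplusplus16_decided.mono rplusplus15_sub_rplusplus16, rplusplus16_decided.mono fun F hF => ?_⟩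
  rcases List.mem_append.1 hF with h | h
  · exact rplus_sub_rplusplus16 F h
  · exact List.mem_append.2 (Or.inr h)

/-- **The four design-class words' current intake lists are inside version 16** (inherited).
[cite: Zhang2022LandauSiegel, §2 (2.32)–(2.33)] -/
theorem rplusplus16_words_sub :
    (∀ F ∈ bmultiWord6, F ∈ Rplusplus16) ∧ (∀ F ∈ blenWord4, F ∈ Rplusplus16) ∧ (∀ F ∈ bdetWord2, F ∈ Rplusplus16) ∧
      (∀ F ∈ bellWord, F ∈ Rplusplus16) :=
  ⟨fun F hF => rplusplus15_sub_rplusplus16 F (rplusplus15_words_sub.1 F hF),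
    fun F hF => rplusplus15_sub_rplusplus16 F (rplusplus15_words_sub.2.1 F hF),
    fun F hF => rplusplus15_sub_rplusplus16 F (rplusplus15_words_sub.2.2.1 F hF),
    fun F hF => rplusplus15_sub_rplusplus16 F (rplusplus15_words_sub.2.2.2 F hF)⟩

/-- **Row 54 is NON-COVERING** (the referee's T-2 probe, by term): beyond the wall (`ν₁ ≥ 1`) its verdict holds for EVERY
`Theta` box with no class hypothesis, because the displayed slot is false there — recorded next to the class of record so
no coverage is ever read into it. [cite: Zhang2022LandauSiegel, §7 (7.2), (7.15)] -/
theorem rplusplus16_row54_vacuous_beyond_wall (θ : Theta) (h1 : 1 ≤ θ.nu1) : familyInPrintCeiling.Verdict θ :=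
  familyInPrintCeiling_verdict_vacuous_beyond_wall θ h1

/-- Rows 14 and 54 have the SAME class and equivalent verdicts on it (`familyInPrintLen_verdict_iff`).
[cite: Zhang2022LandauSiegel, §2 (2.32)–(2.33); §7 (7.15)] -/
theorem rplusplus16_row54_iff_row14 (θ : Theta) (h : familyInPrintLen.InClass θ) :
    familyInPrintCeiling.InClass θ ∧ (familyInPrintCeiling.Verdict θ ↔ familyInPrintLen.Verdict θ) :=
  familyInPrintLen_verdict_iff θ h

end Repair

end Literature.NumberTheory.LFunctions.Zhang2022
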